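import Mathlib
import HarnessLib
import Summits.ValiantsHypothesis.ValiantsHypothesis.Theses.MonotoneRestoration
import Literature.Computability.AlgebraicComplexity.ArithCircuit
import Literature.Computability.AlgebraicComplexity.ArithCircuitProofs
import Literature.Computability.AlgebraicComplexity.MonotoneStructure
import Literature.Computability.AlgebraicComplexity.PermanentIrreducible
import Literature.ModelTheory.FiniteModelTheory.CkEquiv
import Summits.ValiantsHypothesis.ValiantsHypothesis.Theorems.MonotoneRestorationMonotoneRestorationQPCosetCount
import Summits.ValiantsHypothesis.ValiantsHypothesis.Theorems.MonotoneRestorationMonotoneRestorationQPSymmetricLB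
import Summits.ValiantsHypothesis.ValiantsHypothesis.Theorems.MonotoneRestorationMonotoneRestorationQPSupportSymmetrisation
import Summits.ValiantsHypothesis.ValiantsHypothesis.Theorems.MonotoneRestorationMonotoneRestorationQPSparseRegime
import Summits.ValiantsHypothesis.ValiantsHypothesis.Theorems.MonotoneRestorationMonotoneRestorationQPBeta
import Literature.Computability.AlgebraicComplexity.SymmetricArithCircuit
import Literature.Computability.AlgebraicComplexity.DawarWilsenach2025Proofs
import Literature.GroupTheory.PermutationGroups.SmallIndexSubgroups
import Summits.ValiantsHypothesis.ValiantsHypothesis.Theorems.MonotoneRestorationQP.Negative.LoadBearing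
import Summits.ValiantsHypothesis.ValiantsHypothesis.Theorems.MonotoneRestorationMonotoneRestorationQPPermSupportCount

/-! TTRL-lite variant V20056 of stmt-ValiantsHypothesis-15886

Target `stub_gateSupport` (slug `valian15886-stub-gatesupport`), move `specialise` (tightness probe
at `(n, k) = (9, 2)` with the exceptional set forced to be `X = ∅`): the claim "in a
`Sym₉`-symmetric labelled circuit with fewer than `36 = C(9,2)` gates EVERY even permutation
extends to an automorphism fixing EVERY gate" is FALSE. So in `stub_gateSupport` the exceptional
set `X` (of size `< k`) cannot in general be taken empty for `k = 2`.
-/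

-- `Summit.ValiantsHypothesis.ValiantsHypothesis.…` is the tree's mandated single-conjunct layout
-- (Sub = Summit), so the duplicated namespace component is intended.
set_option linter.dupNamespace false

namespace Summit.ValiantsHypothesis.ValiantsHypothesis.Theorems

open Summit.ValiantsHypothesis.ValiantsHypothesis.Theses.MonotoneRestoration
open Literature.Computability.AlgebraicComplexity

/-- **TTRL-lite variant V20056 of `stub_gateSupport` is FALSE** (tightness probe at
`(n, k) = (9, 2)`, `X = ∅`). Witness: the `Sym₉`-symmetric circuit on the ten gates
`Option (Fin 9)` — `some i` is the input gate labelled by the diagonal variable `x_{i,i}`, `none` is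
the `+`-gate over all nine inputs and is the output; `γ ∈ Sym₉` extends to the automorphism
`Equiv.optionCongr γ`, and `10 < 36`. For the gate `g = some 0` and the even permutation
`ρ = (0 1)(1 2)` (a `3`-cycle with `ρ 0 = 1`), any automorphism `π` extending `ρ` must carry `g` to
the gate labelled `x_{ρ 0, ρ 0} = x_{1,1}`, i.e. to `some 1 ≠ g`; so no extension of `ρ` fixes `g`.
[cite: DawarWilsenach2025, Defs. 3.6–3.7] -/
theorem stub_gateSupport_var20056_false :
    ¬ (∀ (K : Type) (G : Type) [Fintype G] (C : LabelledArithCircuit K (Fin 9 × Fin 9) Unit G)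
        (hC : C.IsSymmetric (Equiv.Perm (Fin 9))) (hcard : Fintype.card G < 36) (g : G)
        (ρ : Equiv.Perm (Fin 9)), Equiv.Perm.sign ρ = 1 →
          ∃ π : Equiv.Perm G, C.IsAutomorphismExtending ρ π ∧ π g = g) := by
  intro h
  -- The witness circuit, packaged with the five equations describing it.
  obtain ⟨C, hlab_some, hlab_none, hch_some, hch_none, hout⟩ :
      ∃ C : LabelledArithCircuit ℕ (Fin 9 × Fin 9) Unit (Option (Fin 9)),
        (∀ i, C.label (some i) = .var (i, i)) ∧ C.label none = .add ∧
        (∀ i, C.children (some i) = ∅) ∧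
        C.children none = Finset.univ.map Function.Embedding.some ∧
        (∀ y, C.output y = none) := by
    refine ⟨{ children := fun g => g.elim (Finset.univ.map Function.Embedding.some) fun _ => ∅
              label := fun g => g.elim .add fun i => .var (i, i)
              output := fun _ => none
              wf := ?_
              isInput_iff := ?_
              eq_of_label_eq := ?_
              output_injective := fun _ _ _ => Subsingleton.elim _ _ },
      fun _ => rfl, rfl, fun _ => rfl, rfl, fun _ => rfl⟩
    · -- acyclicity: inputs have no children, the `+`-gate has only inputs as children
      have hsome : ∀ i : Fin 9, Acc (fun h g : Option (Fin 9) =>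
          h ∈ g.elim (Finset.univ.map Function.Embedding.some) fun _ => (∅ : Finset _)) (some i) :=
        fun i => ⟨_, fun h hh => absurd hh (Finset.notMem_empty h)⟩
      refine ⟨fun g => ?_⟩
      cases g with
      | some i => exact hsome i
      | none =>
        refine ⟨_, fun h hh => ?_⟩
        cases h with
        | some i => exact hsome i
        | none => simp at hh
    · intro g
      cases g with
      | some i => simp
      | none =>
        simp only [Option.elim, CircuitLabel.not_isInput_add, false_iff, ← Finset.nonempty_iff_ne_empty]
        exact ⟨some 0, by simp⟩
    · intro g g' hg hl
      cases g with
      | none => simp [Option.elim] at hg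
      | some i =>
        cases g' with
        | none => simp [Option.elim] at hl
        | some j =>
          simp only [Option.elim, CircuitLabel.var.injEq, Prod.mk.injEq] at hl
          rw [hl.1]
  -- The circuit is `Sym₉`-symmetric: `γ` extends to `Equiv.optionCongr γ`.
  have hC : C.IsSymmetric (Equiv.Perm (Fin 9)) := by
    intro γ
    refine ⟨Equiv.optionCongr γ, fun g => ?_, fun g => ?_, fun y => ?_⟩
    · cases g with
      | some i =>
        rw [Equiv.optionCongr_apply, Option.map_some, hch_some, hch_some, Finset.map_empty]
      | none =>
        rw [Equiv.optionCongr_apply, Option.map_none, hch_none, Finset.map_map]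
        ext h
        cases h with
        | none => simp
        | some j => simpa using γ.surjective j
    · cases g with
      | some i =>
        rw [Equiv.optionCongr_apply, Option.map_some, hlab_some, hlab_some, CircuitLabel.smul_var,
          Prod.smul_mk, Equiv.Perm.smul_def]
      | none => rw [Equiv.optionCongr_apply, Option.map_none, hlab_none, CircuitLabel.smul_add]
    · simp only [hout, Equiv.optionCongr_apply, Option.map_none]
  have hcard : Fintype.card (Option (Fin 9)) < 36 := by simp
  -- The even permutation `ρ = (0 1)(1 2)` moves `0` to `1`.
  have hsign : Equiv.Perm.sign (Equiv.swap (0 : Fin 9) 1 * Equiv.swap 1 2) = 1 := by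
    rw [Equiv.Perm.sign_mul, Equiv.Perm.sign_swap (by decide), Equiv.Perm.sign_swap (by decide)]
    decide
  obtain ⟨π, hπ, hπg⟩ := h ℕ (Option (Fin 9)) C hC hcard (some 0) _ hsign
  have hl := hπ.label_apply (some 0)
  rw [hπg, hlab_some, CircuitLabel.smul_var, Prod.smul_mk, Equiv.Perm.smul_def,
    CircuitLabel.var.injEq, Prod.mk.injEq] at hl
  exact absurd hl.1 (by decide)

end Summit.ValiantsHypothesis.ValiantsHypothesis.Theorems
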